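import Summits.CriticalPhenomena.PercolationContinuityZ3.Theorems.FK.Transplant.FHSeedWiring
import Summits.CriticalPhenomena.PercolationContinuityZ3.Theorems.FK.Transplant.FHThreshold
import Summits.CriticalPhenomena.PercolationContinuityZ3.Theorems.FK.Transplant.QComparisonSegment
import HarnessLib

/-!
# FRONTIER TRANSPLANT, binder 1 (FH) calibration — binder 1 travels along the admissible segments of
# Grimmett's Thm. (3.24), and its OWN critical value `p_FH(q; d) := inf {p : FH d q p}` is STRICTLY increasing in `q`

Registered R99 (cell INBOX l.6817, 2026-08-24); registry row T1i; label T1i-B (coordinator fk-4 g205 = the lead′s suggestion L162; the lead may restyle the label on its record line).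
builds on p205010 (kernel theorem, internal audit signed; external expert review pending). CONDITIONAL sub-cell
(FH AND TP_FK open at the same `p` for `q > 1` near `p_c(q)`; ⇔ GRC Conj. (5.103) via K1); the transplant is a typed
reduction, not a proof of FK continuity. Support file (`--supports stmt-CriticalPhenomena-4575`, helper) typed by the
FRONTIER TRANSPLANT seat `prim-bschramm-fkt-p2` (`fk-continuity/transplant/`). No definitions, no named facts, no
sorries; standard axioms.

HONEST FRAMING (page 1, cell rule). This file does NOT touch the transplant's theorem of record
`ufsc0_of_freeBoundaryHypothesis_r3` (p248245, « 2 / 0 ☑ »), which stays CONDITIONAL on FH AND TP_FK (barrier note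
`Literature.Barriers.CriticalPhenomena.SamePFreeBoundaryCriteria`, FBN-01). It is a CALIBRATION leaf of binder 1:
every `FH` concluder below carries an `FH`-type hypothesis (comparison ACROSS `(p, q)`, never verification); nothing
at `p ↓ p_c(q)`; not a binder discharge, not a re-cut, not `_r4`; `n_open = 2`, BINDER-OWNERS, FO-19 NO-GO unchanged.
K1 (verbatim): "[C3a ∀ p > p_c(q)] ∧ C3b ⇒ p̂_c(q) = p_c(q) = GRC Conj (5.103) = DT Question 5 (open for q ∈ (1,2))".

## What is here

T1h (`FHThreshold.lean`) put binder 1's own threshold `p_FH(q; d)` on the books: `∈ [p_c(q), p̂_c(q)]`, non-decreasing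
and `1/4`-Lipschitz in `q ≥ 1` — all from EDGE-BY-EDGE comparisons (Grimmett (3.22)/(3.23)). T1m
(`CriticalPointStrictMono.lean`, `FHSlabThresholdStrictMono.lean`) made the two END POINTS `p_c(q)`, `p̂_c(q)` of the K1
interval STRICTLY increasing in `q` (the second half of Grimmett's Thm. (5.10)), by the comparison of (3.25) type
along explicit admissible segments `rcMeasure_real_le_of_slope` — a statement about HOMOGENEOUS random-cluster measures
with a wired vertex set, which the free look of binder 1 (an edge-parameter law with the seed PINNED OPEN) is not
literally. `FHSeedWiring.lean` supplies the exact bridge (pinning the seed open = deleting its edges and wiring it).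
Hence:

§1 **the free look travels along admissible segments** (`fkLaw_hitW_real_le_of_slope`): for `d ≥ 1`,
`1 ≤ q₂ ≤ q₁`, `0 < p₂ ≤ p₁ < 1` with `4d·q₁(p₁ - p₂) ≤ (q₁ - q₂)·p₂·(1 - p₁)^{2d}`, every increasing event of the
free look of a box `ℓQ ∋ 0` is at most as likely at `(p₁, q₁)` as at `(p₂, q₂)` (degrees `≤ 2d`; no edge of the
deleted graph joins two seed vertices); so `IsHittableFK q₁ p₁ g → IsHittableFK q₂ p₂ g` for every geometry whose box
contains the origin (`IsHittableFK.of_slope`) and **`FH d q₁ p₁ → FH d q₂ p₂`** (`fh_of_fh_of_slope`);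
§2 **`p_FH(q; d)` is STRICTLY increasing in `q` on `[1, ∞)`** (`d ≥ 2`), quantitatively:
`p_FH(q₁) - p_FH(q₂) ≥ (q₁ - q₂)·p_FH(q₁)(1 - p_FH(q₁))^{2d}/(8dq₁)` (`csInf_fhSet_sub_ge`; `csInf_fhSet_lt_of_lt`,
`strictMonoOn_csInf_fhSet`, `injOn_csInf_fhSet`), with `p_FH(q; d) ∈ (0, 1)` (`csInf_fhSet_mem_Ioo`); consequences:
for `1 ≤ q₂ < q₁` binder 1 SEPARATES the two cluster weights — some `p` carries `FH d q₂ p ∧ ¬ FH d q₁ p`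
(`exists_fh_and_not_fh`) — and for `q > 1` binder 1 fails at some `p > p_c(ℤ^d)` (`exists_not_fh_above_criticalProb`).
So all three K1 thresholds `p_c(q) ≤ p_FH(q) ≤ p̂_c(q)` are strictly increasing, `1/4`-Lipschitz curves on `[1, ∞)`.

presearch: Grimmett 2006 Thm. (5.10) / (3.24) (pp. 47–52, 99–101) is the mechanism, stated there for `p_c(q)` only;
a threshold for KN's free-box hittability is not in print (KN 2024 §4 is `q = 1`). Cited as the routine consequence
of (3.25) + (3.7)/(4.13) that it is.

## References

* G. Grimmett, *The Random-Cluster Model*, Springer 2006: Thm. (3.7) p. 39, Lemma (4.13) p. 71, Thm. (3.24)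
  eq. (3.25) p. 47, Prop. (3.28), Thm. (5.5), Thm. (5.10) pp. 99–101, Conj. (5.103). [Grimmett2006]
* G. Kozma, S. Nitzan, arXiv:2401.12397 (2024), §4 p. 16 (hittable geometry), Lemma 9. [KozmaNitzan2024]
-/

noncomputable section

open scoped Classical
open Filter Topology MeasureTheory Finset SimpleGraph

namespace Summit.CriticalPhenomena.PercolationContinuityZ3.Theorems.FK

open Literature.Probability.Percolation Literature.Probability.LatticeModels
open Literature.Probability.Percolation.GadgetSystem Literature.Probability.Percolation.KozmaNitzan
open Literature.Barriers.CriticalPhenomena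

variable {d : ℕ}

/-! ### §1 The free look along admissible segments -/

section Slope

/-- A spanning subgraph of an induced subgraph of `ℤ^d` has all degrees `≤ 2d`.
[cite: Grimmett2006, proof of Thm. (5.10) p. 101 ("deg(W) = 2d")] -/
theorem fromEdgeSet_degree_le_two_mul {Q : Finset (Site d)} {U : Finset (Sym2 ↥Q)}
    (hU : U ⊆ (finsetGraph (zdGraph d) Q).edgeFinset) (x : ↥Q) :
    (fromEdgeSet (↑U : Set (Sym2 ↥Q))).degree x ≤ 2 * d := by
  have hle : fromEdgeSet (↑U : Set (Sym2 ↥Q)) ≤ finsetGraph (zdGraph d) Q := by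
    intro a b hab
    rw [fromEdgeSet_adj] at hab
    have := hU (Finset.mem_coe.1 hab.1)
    rwa [SimpleGraph.mem_edgeFinset, SimpleGraph.mem_edgeSet] at this
  refine (degree_le_of_le hle).trans ?_
  -- an induced subgraph of `ℤ^d` has degrees `≤ 2d` (as T1m-G's `finsetGraph_zdGraph_degree_le`)
  rw [← card_neighborFinset_zdGraph_holds (x : Site d), ← SimpleGraph.card_neighborFinset_eq_degree]
  refine Finset.card_le_card_of_injOn Subtype.val (fun z hz => ?_) (Set.injOn_of_injective Subtype.val_injective)
  rw [Finset.mem_coe, SimpleGraph.mem_neighborFinset] at hz ⊢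
  exact hz

/-- `0 ∈ ℓQ_g` for every `ℓ` as soon as `0 ∈ Q_g` (all of KN's geometries have `Q = [-1,1]^d ∋ 0`). [folklore] -/
theorem zero_mem_Qset_of_zero_mem_Icc (g : Geom d) (hg : (0 : Site d) ∈ Finset.Icc g.loQ g.hiQ) (ℓ : ℕ) :
    (0 : Site d) ∈ g.Qset ℓ 0 := by
  rw [Geom.Qset, mem_Icc_iff]
  rw [mem_Icc_iff] at hg
  intro i
  have h := hg i
  have hℓ : (0 : ℤ) ≤ ℓ := Nat.cast_nonneg ℓ
  simp only [Pi.zero_apply, Pi.add_apply, Pi.smul_apply, smul_eq_mul, zero_add] at h ⊢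
  constructor <;> nlinarith [h.1, h.2, hℓ]

/-- **The free look travels along admissible segments** (Grimmett's Thm. (3.24) for binder 1's law). Let `d ≥ 1`,
`1 ≤ q₂ ≤ q₁`, `0 < p₂ ≤ p₁ < 1` with `4d·q₁(p₁ - p₂) ≤ (q₁ - q₂)·p₂·(1 - p₁)^{2d}`, and `0 ∈ ℓQ_g`. Then for every
increasing measurable event `A`, `fkLaw ℓQ (hitW p₁ g ℓ m 0) q₁ (A) ≤ fkLaw ℓQ (hitW p₂ g ℓ m 0) q₂ (A)`: lowering the
cluster weight from `q₁` to `q₂` beats lowering the edge weight from `p₁` to `p₂`. Proof: both sides are the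
homogeneous measure `φ^{Λ_m ∩ ℓQ}_{⟨E(ℓQ) ∖ E(Λ_m)⟩, ·, ·}` of one increasing event (`fkLaw_hitW_real_eq_rcMeasure_seedWired`);
the deleted graph has degrees `≤ 2d` and no edge with both end points in the (wired) seed; T1m
`rcMeasure_real_le_of_slope`. [cite: Grimmett2006, Thm. (3.24) eq. (3.25) p. 47, Thm. (3.7) p. 39, Lemma (4.13) p. 71] -/
theorem fkLaw_hitW_real_le_of_slope (hd : 1 ≤ d) {p₁ p₂ : unitInterval} {q₁ q₂ : ℝ} (hq₂ : 1 ≤ q₂) (hq : q₂ ≤ q₁)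
    (hp₂ : 0 < (p₂ : ℝ)) (hp : (p₂ : ℝ) ≤ p₁) (hp₁ : (p₁ : ℝ) < 1)
    (hslope : 4 * d * q₁ * ((p₁ : ℝ) - p₂) ≤ (q₁ - q₂) * p₂ * (1 - (p₁ : ℝ)) ^ (2 * d))
    (g : Geom d) {ℓ : ℕ} (h0 : (0 : Site d) ∈ g.Qset ℓ 0) (m : ℕ)
    {A : Set (BondConfig (Site d))} (hA : MeasurableSet A) (hAup : IsUpperSet A) :
    (fkLaw (g.Qset ℓ 0) (hitW p₁ g ℓ m 0) q₁).real A ≤ (fkLaw (g.Qset ℓ 0) (hitW p₂ g ℓ m 0) q₂).real A := by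
  have hq₁0 : 0 < q₁ := by linarith
  have hq₂0 : 0 < q₂ := by linarith
  have hp₁0 : 0 < (p₁ : ℝ) := hp₂.trans_le hp
  rw [fkLaw_hitW_real_eq_rcMeasure_seedWired hq₁0 p₁ hp₁0 g h0 m hA,
    fkLaw_hitW_real_eq_rcMeasure_seedWired hq₂0 p₂ hp₂ g h0 m hA]
  refine rcMeasure_real_le_of_slope hq₂ hq hp₂ hp hp₁ _ (Δ := 2 * d) (by omega)
    (fun x _ => by convert fromEdgeSet_degree_le_two_mul Finset.sdiff_subset x using 2) ?_ ?_ ?_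
  · push_cast; linarith
  · intro η η' hle hη
    exact isUpperSet_preimage_liftEdges _ hAup (Set.union_subset_union_left _ hle) hη
  · -- no edge of the deleted graph has both end points in the seed
    intro ω e he heW
    exfalso
    rw [edgeSet_fromEdgeSet] at he
    have heU := Finset.mem_sdiff.1 (Finset.mem_coe.1 he.1)
    apply heU.2
    rw [Finset.mem_filter]
    refine ⟨heU.1, mem_edgesIn_iff.2 ⟨?_, fun z hz => ?_⟩⟩
    · have heG := heU.1
      induction e using Sym2.ind with
      | h x y =>
        rw [Sym2.map_mk, SimpleGraph.mem_edgeSet]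
        rw [SimpleGraph.mem_edgeFinset, SimpleGraph.mem_edgeSet] at heG
        exact heG
    · obtain ⟨x, hx, rfl⟩ := Sym2.mem_map.1 hz
      exact heW x hx

/-- **FK-hittability travels along admissible segments**: under the hypotheses of `fkLaw_hitW_real_le_of_slope`,
for every geometry whose box `Q_g` contains the origin, `IsHittableFK q₁ p₁ g → IsHittableFK q₂ p₂ g` (same
thresholds `k, ℓ₀`). [cite: KozmaNitzan2024, §4 p. 16 (hittable geometry); Grimmett2006, Thm. (3.24) eq. (3.25) p. 47] -/
theorem IsHittableFK.of_slope (hd : 1 ≤ d) {p₁ p₂ : unitInterval} {q₁ q₂ : ℝ} (hq₂ : 1 ≤ q₂) (hq : q₂ ≤ q₁)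
    (hp₂ : 0 < (p₂ : ℝ)) (hp : (p₂ : ℝ) ≤ p₁) (hp₁ : (p₁ : ℝ) < 1)
    (hslope : 4 * d * q₁ * ((p₁ : ℝ) - p₂) ≤ (q₁ - q₂) * p₂ * (1 - (p₁ : ℝ)) ^ (2 * d))
    {g : Geom d} (hg : (0 : Site d) ∈ Finset.Icc g.loQ g.hiQ) (h : IsHittableFK q₁ p₁ g) :
    IsHittableFK q₂ p₂ g := by
  refine ⟨fun ε hε => ?_⟩
  obtain ⟨k, ℓ₀, hk⟩ := h.hit ε hε
  refine ⟨k, ℓ₀, fun m hm ℓ hℓ => (hk m hm ℓ hℓ).trans_le ?_⟩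
  exact fkLaw_hitW_real_le_of_slope hd hq₂ hq hp₂ hp hp₁ hslope g (zero_mem_Qset_of_zero_mem_Icc g hg ℓ) m
    (measurableSet_linkIn _ _ _) (isUpperSet_linkIn_site _ _ _)

/-- **Binder 1 travels along admissible segments**: for `d ≥ 1`, `1 ≤ q₂ ≤ q₁`, `0 < p₂ ≤ p₁ < 1` with
`4d·q₁(p₁ - p₂) ≤ (q₁ - q₂)·p₂·(1 - p₁)^{2d}`: `FH d q₁ p₁ → FH d q₂ p₂` (the quarter-face geometries have
`Q = [-1,1]^d ∋ 0`). A comparison across `(p, q)` — binder 1 is NOT verified anywhere.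
[cite: KozmaNitzan2024, §4 Lemma 9 (p. 16); Grimmett2006, Thm. (3.24) eq. (3.25) p. 47, Conj. (5.103)] -/
theorem fh_of_fh_of_slope (hd : 1 ≤ d) {p₁ p₂ : unitInterval} {q₁ q₂ : ℝ} (hq₂ : 1 ≤ q₂) (hq : q₂ ≤ q₁)
    (hp₂ : 0 < (p₂ : ℝ)) (hp : (p₂ : ℝ) ≤ p₁) (hp₁ : (p₁ : ℝ) < 1)
    (hslope : 4 * d * q₁ * ((p₁ : ℝ) - p₂) ≤ (q₁ - q₂) * p₂ * (1 - (p₁ : ℝ)) ^ (2 * d))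
    (h : FH d q₁ p₁) : FH d q₂ p₂ := by
  intro g hg
  obtain ⟨x, -, rfl⟩ := List.mem_map.1 hg
  refine (h _ hg).of_slope hd hq₂ hq hp₂ hp hp₁ hslope ?_
  rw [mem_Icc_iff]
  intro i
  simp [qfGeom]

end Slope

/-! ### §2 `p_FH(q; d)` is STRICTLY increasing in `q` -/

section Strict

/-- **`p_FH(q; d) ∈ (0, 1)`** (`d ≥ 2`, `q ≥ 1`): `0 < p_c(q) ≤ p_FH(q; d)` (T1h, fkp-01 `rcCriticalProb_mem_Ioo`) and
`p_FH(q; d) ≤ q·p_c(ℤ^d)/(1 + (q-1)·p_c(ℤ^d)) < 1` (T1h `csInf_fhSet_le_ratio_criticalProb`, `p_c(ℤ^d) < 1`).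
[cite: Grimmett2006, Thm. (5.5), Conj. (5.103); KozmaNitzan2024, §4 Lemma 9 (p. 16)] -/
theorem csInf_fhSet_mem_Ioo (hd : 2 ≤ d) {q : ℝ} (hq : 1 ≤ q) :
    sInf {x : ℝ | ∃ p : unitInterval, (p : ℝ) = x ∧ FH d q p} ∈ Set.Ioo (0 : ℝ) 1 := by
  refine ⟨(rcCriticalProb_mem_Ioo hd hq).1.trans_le (rcCriticalProb_le_csInf_fhSet hd hq),
    (csInf_fhSet_le_ratio_criticalProb hd hq).trans_lt ?_⟩
  set c := criticalProb (zdGraph d) 0 with hc_def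
  have hc : c ∈ Set.Icc (0 : ℝ) 1 := criticalProb_mem_Icc (zdGraph d) 0
  have hc1 : c < 1 := criticalProb_zd_lt_one hd
  have hden : 0 < 1 + (q - 1) * c := by nlinarith [hc.1]
  rw [div_lt_one hden]
  nlinarith [hc.1]

/-- **Quantitative strict monotonicity of binder 1's threshold in `q`**: for `d ≥ 2` and `1 ≤ q₂ ≤ q₁`,
`p_FH(q₁; d) - p_FH(q₂; d) ≥ (q₁ - q₂) · p_FH(q₁; d)(1 - p_FH(q₁; d))^{2d} / (8dq₁)`. Proof as for T1m's
`rcCriticalProb_sub_ge` / `fkSlabCriticalProb_sub_ge`: above `p_FH(q₁)` binder 1 holds at `q₁` (T1h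
`fh_of_csInf_fhSet_lt`), hence at `(q₂, p₁ - δ)` with `δ = (q₁-q₂)p₁(1-p₁)^{2d}/(8dq₁)` (`fh_of_fh_of_slope`), so
`p_FH(q₂) ≤ p₁ - δ`; let `p₁ ↓ p_FH(q₁)`. [cite: Grimmett2006, Thm. (5.10) and its proof (5.14)–(5.15) pp. 99–101, Thm. (3.24)] -/
theorem csInf_fhSet_sub_ge (hd : 2 ≤ d) {q₁ q₂ : ℝ} (hq₂ : 1 ≤ q₂) (hq : q₂ ≤ q₁) :
    (q₁ - q₂) * (sInf {x : ℝ | ∃ p : unitInterval, (p : ℝ) = x ∧ FH d q₁ p} *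
        (1 - sInf {x : ℝ | ∃ p : unitInterval, (p : ℝ) = x ∧ FH d q₁ p}) ^ (2 * d)) / (8 * d * q₁) ≤
      sInf {x : ℝ | ∃ p : unitInterval, (p : ℝ) = x ∧ FH d q₁ p} -
        sInf {x : ℝ | ∃ p : unitInterval, (p : ℝ) = x ∧ FH d q₂ p} := by
  have hq₁ : 1 ≤ q₁ := hq₂.trans hq
  have hq₁0 : 0 < q₁ := one_pos.trans_le hq₁
  have hd1 : 1 ≤ d := le_of_lt hd
  have hdr : (0 : ℝ) < d := Nat.cast_pos.2 (by omega)
  set c := sInf {x : ℝ | ∃ p : unitInterval, (p : ℝ) = x ∧ FH d q₁ p} with hc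
  have hcI : c ∈ Set.Ioo (0 : ℝ) 1 := csInf_fhSet_mem_Ioo hd hq₁
  set g : ℝ → ℝ := fun p => p - (q₁ - q₂) * (p * (1 - p) ^ (2 * d)) / (8 * d * q₁) with hg
  have hbound : ∀ p₁ ∈ Set.Ioo c 1, sInf {x : ℝ | ∃ p : unitInterval, (p : ℝ) = x ∧ FH d q₂ p} ≤ g p₁ := by
    intro p₁ hp₁
    have hp₁0 : 0 < p₁ := hcI.1.trans hp₁.1
    set δ := (q₁ - q₂) * (p₁ * (1 - p₁) ^ (2 * d)) / (8 * d * q₁) with hδ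
    have hδ0 : 0 ≤ δ := by
      have : 0 ≤ (1 - p₁) ^ (2 * d) := pow_nonneg (sub_nonneg.2 hp₁.2.le) _
      have : 0 ≤ (q₁ - q₂) * (p₁ * (1 - p₁) ^ (2 * d)) :=
        mul_nonneg (sub_nonneg.2 hq) (mul_nonneg hp₁0.le this)
      positivity
    have hδle : δ ≤ p₁ / 2 := by
      have h1 : (1 - p₁) ^ (2 * d) ≤ 1 := pow_le_one₀ (sub_nonneg.2 hp₁.2.le) (sub_le_self 1 hp₁0.le)
      have h2 : (q₁ - q₂) * (p₁ * (1 - p₁) ^ (2 * d)) ≤ q₁ * p₁ := by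
        have : (q₁ - q₂) ≤ q₁ := by linarith
        calc (q₁ - q₂) * (p₁ * (1 - p₁) ^ (2 * d)) ≤ q₁ * (p₁ * (1 - p₁) ^ (2 * d)) :=
              mul_le_mul_of_nonneg_right this (mul_nonneg hp₁0.le (pow_nonneg (sub_nonneg.2 hp₁.2.le) _))
          _ ≤ q₁ * (p₁ * 1) := mul_le_mul_of_nonneg_left (mul_le_mul_of_nonneg_left h1 hp₁0.le) hq₁0.le
          _ = q₁ * p₁ := by ring
      have hd1r : (1 : ℝ) ≤ d := by exact_mod_cast hd1
      have h3 : 0 ≤ q₁ * p₁ * (4 * d - 1) := mul_nonneg (mul_pos hq₁0 hp₁0).le (by linarith)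
      rw [hδ, div_le_iff₀ (by positivity)]
      nlinarith [h2, h3]
    have hp₂0 : 0 < p₁ - δ := by linarith
    have hp₂le : p₁ - δ ≤ p₁ := by linarith
    have hslope : 4 * d * q₁ * (p₁ - (p₁ - δ)) ≤ (q₁ - q₂) * (p₁ - δ) * (1 - p₁) ^ (2 * d) := by
      have e : 4 * d * q₁ * (p₁ - (p₁ - δ)) = (q₁ - q₂) * (p₁ / 2) * (1 - p₁) ^ (2 * d) := by
        rw [hδ]
        field_simp
        ring
      rw [e]
      have : 0 ≤ (q₁ - q₂) * (1 - p₁) ^ (2 * d) :=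
        mul_nonneg (sub_nonneg.2 hq) (pow_nonneg (sub_nonneg.2 hp₁.2.le) _)
      nlinarith
    -- binder 1 at `(q₁, p₁)`, transported to `(q₂, p₁ - δ)`
    have hFH₁ : FH d q₁ ⟨p₁, hp₁0.le, hp₁.2.le⟩ := fh_of_csInf_fhSet_lt hd hq₁ hp₁.1
    have hFH₂ : FH d q₂ ⟨p₁ - δ, hp₂0.le, hp₂le.trans hp₁.2.le⟩ :=
      fh_of_fh_of_slope (p₁ := ⟨p₁, hp₁0.le, hp₁.2.le⟩) (p₂ := ⟨p₁ - δ, hp₂0.le, hp₂le.trans hp₁.2.le⟩)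
        hd1 hq₂ hq hp₂0 hp₂le hp₁.2 hslope hFH₁
    have := csInf_fhSet_le_of_fh hFH₂
    simpa [hg, hδ] using this
  have hcont : Tendsto g (𝓝[>] c) (𝓝 (g c)) := by
    have : Continuous g := by
      rw [hg]
      fun_prop
    exact (this.tendsto c).mono_left nhdsWithin_le_nhds
  have hev : ∀ᶠ p₁ in 𝓝[>] c, sInf {x : ℝ | ∃ p : unitInterval, (p : ℝ) = x ∧ FH d q₂ p} ≤ g p₁ :=
    eventually_of_mem (Ioo_mem_nhdsGT hcI.2) hbound
  have hle : sInf {x : ℝ | ∃ p : unitInterval, (p : ℝ) = x ∧ FH d q₂ p} ≤ g c := ge_of_tendsto hcont hev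
  simp only [hg] at hle
  linarith

/-- **`p_FH(q; d)` is STRICTLY increasing in `q` on `[1, ∞)`** (`d ≥ 2`; the monotone / Lipschitz halves are T1h
`csInf_fhSet_mono` / `lipschitzOnWith_csInf_fhSet`). With T1m: all three K1 thresholds `p_c(q) ≤ p_FH(q) ≤ p̂_c(q)`
are strictly increasing in `q`. [cite: Grimmett2006, Thm. (5.10) pp. 99–101 with Thm. (3.24); KozmaNitzan2024, §4 Lemma 9 (p. 16)] -/
theorem csInf_fhSet_lt_of_lt (hd : 2 ≤ d) {q₁ q₂ : ℝ} (hq₂ : 1 ≤ q₂) (hq : q₂ < q₁) :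
    sInf {x : ℝ | ∃ p : unitInterval, (p : ℝ) = x ∧ FH d q₂ p} <
      sInf {x : ℝ | ∃ p : unitInterval, (p : ℝ) = x ∧ FH d q₁ p} := by
  have h := csInf_fhSet_sub_ge hd hq₂ hq.le
  have hcI := csInf_fhSet_mem_Ioo hd (hq₂.trans hq.le)
  have hdr : (0 : ℝ) < d := Nat.cast_pos.2 (by omega)
  have hpos : 0 < (q₁ - q₂) * (sInf {x : ℝ | ∃ p : unitInterval, (p : ℝ) = x ∧ FH d q₁ p} *
      (1 - sInf {x : ℝ | ∃ p : unitInterval, (p : ℝ) = x ∧ FH d q₁ p}) ^ (2 * d)) / (8 * d * q₁) := by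
    have : 0 < 1 - sInf {x : ℝ | ∃ p : unitInterval, (p : ℝ) = x ∧ FH d q₁ p} := sub_pos.2 hcI.2
    have hq₁ : 0 < q₁ := one_pos.trans_le (hq₂.trans hq.le)
    have : 0 < q₁ - q₂ := sub_pos.2 hq
    have := hcI.1
    positivity
  linarith

/-- `q ↦ p_FH(q; d)` is strictly monotone on `[1, ∞)` (`d ≥ 2`). [cite: Grimmett2006, Thm. (5.10) pp. 99–101 with Thm. (3.24)] -/
theorem strictMonoOn_csInf_fhSet (hd : 2 ≤ d) :
    StrictMonoOn (fun q : ℝ => sInf {x : ℝ | ∃ p : unitInterval, (p : ℝ) = x ∧ FH d q p}) (Set.Ici 1) :=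
  fun _ hq₂ _ _ hlt => csInf_fhSet_lt_of_lt hd hq₂ hlt

/-- `q ↦ p_FH(q; d)` is injective on `[1, ∞)` (`d ≥ 2`): distinct cluster weights have distinct binder-1
thresholds. [cite: Grimmett2006, Thm. (5.10) pp. 99–101 with Thm. (3.24)] -/
theorem injOn_csInf_fhSet (hd : 2 ≤ d) :
    Set.InjOn (fun q : ℝ => sInf {x : ℝ | ∃ p : unitInterval, (p : ℝ) = x ∧ FH d q p}) (Set.Ici 1) :=
  (strictMonoOn_csInf_fhSet hd).injOn

/-- **Binder 1 separates cluster weights**: for `d ≥ 2` and `1 ≤ q₂ < q₁` there is an edge weight `p` at which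
binder 1 holds for `q₂` and FAILS for `q₁` (any `p` strictly between the two thresholds).
[cite: Grimmett2006, Thm. (5.10) pp. 99–101; KozmaNitzan2024, §4 Lemma 9 (p. 16)] -/
theorem exists_fh_and_not_fh (hd : 2 ≤ d) {q₁ q₂ : ℝ} (hq₂ : 1 ≤ q₂) (hq : q₂ < q₁) :
    ∃ p : unitInterval, FH d q₂ p ∧ ¬ FH d q₁ p := by
  obtain ⟨x, hx₂, hx₁⟩ := exists_between (csInf_fhSet_lt_of_lt hd hq₂ hq)
  have hI₂ := csInf_fhSet_mem_Ioo hd hq₂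
  have hI₁ := csInf_fhSet_mem_Ioo hd (hq₂.trans hq.le)
  have hx0 : 0 ≤ x := (hI₂.1.trans hx₂).le
  have hx1 : x ≤ 1 := (hx₁.trans hI₁.2).le
  exact ⟨⟨x, hx0, hx1⟩, fh_of_csInf_fhSet_lt hd hq₂ hx₂, not_fh_of_lt_csInf_fhSet hx₁⟩

/-- **For `q > 1` binder 1 fails somewhere above `p_c(ℤ^d)`** (`d ≥ 2`): `p_c(ℤ^d) = p_FH(1; d) < p_FH(q; d)`
(T1h `csInf_fhSet_one_eq_criticalProb`, KN Lemma 9), so some `p > p_c(ℤ^d)` has `¬ FH d q p` — whereas at `q = 1`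
binder 1 holds at every `p ∈ (p_c(ℤ^d), 1)`. [cite: KozmaNitzan2024, §4 Lemma 9 (p. 16); Grimmett2006, Thm. (5.10) pp. 99–101] -/
theorem exists_not_fh_above_criticalProb (hd : 2 ≤ d) {q : ℝ} (hq : 1 < q) :
    ∃ p : unitInterval, criticalProb (zdGraph d) 0 < (p : ℝ) ∧ ¬ FH d q p := by
  obtain ⟨x, hx₂, hx₁⟩ := exists_between (csInf_fhSet_lt_of_lt hd le_rfl hq)
  rw [csInf_fhSet_one_eq_criticalProb hd] at hx₂
  have hI₁ := csInf_fhSet_mem_Ioo hd hq.le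
  have hx0 : 0 ≤ x := ((criticalProb_mem_Icc (zdGraph d) 0).1.trans_lt hx₂).le
  have hx1 : x ≤ 1 := (hx₁.trans hI₁.2).le
  exact ⟨⟨x, hx0, hx1⟩, hx₂, not_fh_of_lt_csInf_fhSet hx₁⟩

/-- `p_c(ℤ^d) < p_FH(q; d)` for `q > 1` (`d ≥ 2`). [cite: KozmaNitzan2024, §4 Lemma 9 (p. 16); Grimmett2006, Thm. (5.10) pp. 99–101] -/
theorem criticalProb_lt_csInf_fhSet (hd : 2 ≤ d) {q : ℝ} (hq : 1 < q) :
    criticalProb (zdGraph d) 0 < sInf {x : ℝ | ∃ p : unitInterval, (p : ℝ) = x ∧ FH d q p} := by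
  rw [← csInf_fhSet_one_eq_criticalProb hd]
  exact csInf_fhSet_lt_of_lt hd le_rfl hq

end Strict

end Summit.CriticalPhenomena.PercolationContinuityZ3.Theorems.FK

end
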